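import Summits.Ventures.PercRepro.PuncturedLYMAvoid

/-!
# PercRepro — (SP) BY SUPERPOSITION, PART 14 (continued): THE POINT-AVOIDING BOUNDS AND (SP) FROM THE REFINED
CERTIFICATES (p10, gen 32)

At a completion `X ↦ insert y X` every word THROUGH `y` contributes `+g(a) ≥ 0` to the superposition, so only the words
AVOIDING `y` count in the deficit: `superW ≥ (1 − Σ_{B ∌ y} e(#(X ∩ B)))/(n − j)` (`superW_ge_avoid`); likewise the
positive error of a word `B` at a point `x` comes only from the words avoiding `x` (`max_errE_le_avoid`).  With the
avoiding certificate bounds of PuncturedLYMAvoid (the counts `sʸ_a = C(j,a)·C(n−j−1, j−1−a)` in place of `s_a`) and the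
through-point certificate of PuncturedLYMChainNeg2:
* **`puncturedNMP_of_cert3`** — (SP) for every code on `(n, j)` with
  `Σ_{a<j} λ_a sʸ_a + (max (Σ_{a<j−1} λ_a sʸ_a) Q + (j − 1)·Q)/j ≤ 1`, `Q = Σ_{a<j−1} μ_a s'_a` (`2 ≤ j`, `2j + 1 ≤ n`).
With the greedy certificates this bound is below `1` on every `(n, j)` with `2j + 1 ≤ n ≤ 3j − 3` tested (`j ≤ 200`;
at `n = 2j + 1` it is `1 − ≈ 3/j`), where the two-certificate bound of PuncturedLYMChainAssembly exceeds `1` from `j = 16`.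
Nothing here asserts (SP) in general.
-/

namespace PercRepro.PuncturedLYM

open Finset

variable {α : Type} [Fintype α] [DecidableEq α]

/-! ### The superposition and the positive error through the avoiding words -/

/-- **The superposition is at least `(1 − Nʸ(X))/(n − j)`**, `Nʸ(X) = Σ_{B ∈ D, y ∉ B} e(#(X ∩ B))`: the words through
`y` are at least uniform at the completion `X ↦ insert y X` (`2j ≤ n`, `j < n`). -/
theorem superW_ge_avoid {j : ℕ} {D : Finset (Finset α)} (hD : IsCode j D) (hn : 2 * j ≤ Fintype.card α)
    (hjn : j < Fintype.card α) (X : Finset α) (y : α) :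
    (1 - ∑ B ∈ D.filter (fun B => y ∉ B), eDef α j (X ∩ B).card) / ((Fintype.card α : ℚ) - j) ≤
      superW α j D X y := by
  unfold superW
  have hnj : (0 : ℚ) < (Fintype.card α : ℚ) - j := by
    have : (j : ℚ) < Fintype.card α := by exact_mod_cast hjn
    linarith
  have h1 : ∀ B ∈ D.filter (fun B => y ∉ B),
      (1 - eDef α j (X ∩ B).card) / ((Fintype.card α : ℚ) - j) ≤ sW α j (dFlux α j) B X y :=
    fun B hB => sW_ge (hD.1 B (mem_filter.1 hB).1) X hn hjn y
  have h2 : ∀ B ∈ D.filter (fun B => ¬ y ∉ B), 1 / ((Fintype.card α : ℚ) - j) ≤ sW α j (dFlux α j) B X y := by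
    intro B hB
    rw [mem_filter, not_not] at hB
    unfold sW
    rw [if_pos hB.2]
    unfold win
    apply div_le_div_of_nonneg_right _ hnj.le
    have hd : 0 ≤ dFlux α j (aOf B X) := dFlux_nonneg hjn.le
    have h0 : (0 : ℚ) ≤ (Fintype.card α : ℚ) - 2 * j + aOf B X := by
      have : (2 * j : ℚ) ≤ Fintype.card α := by exact_mod_cast hn
      have : (0 : ℚ) ≤ (aOf B X : ℚ) := by positivity
      linarith
    have := mul_nonneg h0 hd
    linarith
  have hs := sum_le_sum h1
  have hs2 := sum_le_sum h2
  rw [← sum_filter_add_sum_filter_not D (fun B => y ∉ B)]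
  rw [← sum_div, sum_sub_distrib, sum_const, nsmul_eq_mul, mul_one] at hs
  rw [sum_const, nsmul_eq_mul] at hs2
  have hcard : ((D.filter (fun B => y ∉ B)).card : ℚ) + ((D.filter (fun B => ¬ y ∉ B)).card : ℚ) = D.card := by
    have := card_filter_add_card_filter_not (fun B => y ∉ B) (s := D)
    exact_mod_cast this
  have e : (1 - ∑ B ∈ D.filter (fun B => y ∉ B), eDef α j (X ∩ B).card) / ((Fintype.card α : ℚ) - j) =
      (((D.filter (fun B => y ∉ B)).card : ℚ) - ∑ B ∈ D.filter (fun B => y ∉ B), eDef α j (X ∩ B).card) /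
          ((Fintype.card α : ℚ) - j) +
        ((D.filter (fun B => ¬ y ∉ B)).card : ℚ) * (1 / ((Fintype.card α : ℚ) - j)) -
        ((D.card : ℚ) - 1) / ((Fintype.card α : ℚ) - j) := by
    rw [← hcard]
    field_simp
    ring
  rw [e]
  linarith

/-- **The positive error of a word at `x` comes from the words avoiding `x`**:
`errE(x)⁺ ≤ Σ_{B' ∈ D, B' ≠ B, x ∉ B'} e(#(B ∩ B'))/(n − j)` (`2j ≤ n`, `j < n`). -/
theorem max_errE_le_avoid {j : ℕ} {D : Finset (Finset α)} (hD : IsCode j D) (hn : 2 * j ≤ Fintype.card α)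
    (hjn : j < Fintype.card α) {B : Finset α} (hB : B ∈ D) (x : α) :
    max (errE α j D B x) 0 ≤
      (∑ B' ∈ (D.erase B).filter (fun B' => x ∉ B'), eDef α j (B ∩ B').card) / ((Fintype.card α : ℚ) - j) := by
  have hnj : (0 : ℚ) < (Fintype.card α : ℚ) - j := by
    have : (j : ℚ) < Fintype.card α := by exact_mod_cast hjn
    linarith
  apply max_le _ (div_nonneg (sum_nonneg (fun B' _ =>
    eDef_nonneg ((hD.1 B hB) ▸ card_le_card inter_subset_left) hjn.le)) hnj.le)
  unfold errE
  rw [sum_div, ← sum_filter_add_sum_filter_not (D.erase B) (fun B' => x ∉ B')]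
  have h1 : ∀ B' ∈ (D.erase B).filter (fun B' => x ∉ B'),
      1 / ((Fintype.card α : ℚ) - j) - sW α j (dFlux α j) B' B x ≤
        eDef α j (B ∩ B').card / ((Fintype.card α : ℚ) - j) := by
    intro B' hB'
    rw [mem_filter] at hB'
    have := sW_ge (hD.1 B' (mem_of_mem_erase hB'.1)) B hn hjn x
    have e : 1 / ((Fintype.card α : ℚ) - j) - (1 - eDef α j (B ∩ B').card) / ((Fintype.card α : ℚ) - j) =
        eDef α j (B ∩ B').card / ((Fintype.card α : ℚ) - j) := by
      field_simp
      ring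
    linarith
  have h2 : ∀ B' ∈ (D.erase B).filter (fun B' => ¬ x ∉ B'),
      1 / ((Fintype.card α : ℚ) - j) - sW α j (dFlux α j) B' B x ≤ 0 := by
    intro B' hB'
    rw [mem_filter, not_not] at hB'
    unfold sW
    rw [if_pos hB'.2]
    unfold win
    rw [sub_nonpos]
    apply div_le_div_of_nonneg_right _ hnj.le
    have hd : 0 ≤ dFlux α j (aOf B' B) := dFlux_nonneg hjn.le
    have h0 : (0 : ℚ) ≤ (Fintype.card α : ℚ) - 2 * j + aOf B' B := by
      have : (2 * j : ℚ) ≤ Fintype.card α := by exact_mod_cast hn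
      have : (0 : ℚ) ≤ (aOf B' B : ℚ) := by positivity
      linarith
    have := mul_nonneg h0 hd
    linarith
  have hs1 := sum_le_sum h1
  have hs2 := sum_nonpos h2
  linarith

/-! ### (SP) from the refined certificates -/

/-- **(SP) from the point-avoiding certificates** (`2 ≤ j`, `2j + 1 ≤ n`): `λ ≥ 0` with `e(a) ≤ (j − a)λ_a + aλ_{a−1}`
(the profile) and `μ ≥ 0` with `g(a) ≤ (j − 1 − a)μ_a + aμ_{a−1}` (the words through a point), such that
`Σ_{a<j} λ_a sʸ_a + (max (Σ_{a<j−1} λ_a sʸ_a) (Σ_{a<j−1} μ_a s'_a) + (j − 1)·Σ_{a<j−1} μ_a s'_a)/j ≤ 1`, with the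
avoiding counts `sʸ_a = C(j,a)·C(n−j−1, j−1−a)`. -/
theorem puncturedNMP_of_cert3 {j : ℕ} {D : Finset (Finset α)} (hD : IsCode j D) (hj : 2 ≤ j)
    (hn : 2 * j + 1 ≤ Fintype.card α) (lam mu : ℕ → ℚ) (hlam : ∀ a, a < j → 0 ≤ lam a)
    (hcert : ∀ a, a < j → eDef α j a ≤ ((j : ℚ) - a) * lam a + (a : ℚ) * lam (a - 1))
    (hmu : ∀ a, a + 2 ≤ j → 0 ≤ mu a)
    (hcertm : ∀ a, a + 2 ≤ j → gDef α j a ≤ ((j : ℚ) - 1 - a) * mu a + (a : ℚ) * mu (a - 1))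
    (hbound : ∑ a ∈ range j, lam a * sQy α j a +
      (max (∑ a ∈ range (j - 1), lam a * sQy α j a) (∑ a ∈ range (j - 1), mu a * sQ' α j a) +
        ((j : ℚ) - 1) * ∑ a ∈ range (j - 1), mu a * sQ' α j a) / j ≤ 1) :
    PuncturedNMP j D := by
  have hjn : j < Fintype.card α := by omega
  have hj0 : 0 < j := by omega
  have hj1 : 1 ≤ j := by omega
  have hn2 : 2 * j ≤ Fintype.card α := by omega
  have hnj : (0 : ℚ) < (Fintype.card α : ℚ) - j := by
    have : (j : ℚ) < Fintype.card α := by exact_mod_cast hjn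
    linarith
  have hjq : (0 : ℚ) < j := by exact_mod_cast hj0
  set NX : ℚ := ∑ a ∈ range j, lam a * sQy α j a with hNX
  set NB : ℚ := ∑ a ∈ range (j - 1), lam a * sQy α j a with hNB
  set Q : ℚ := ∑ a ∈ range (j - 1), mu a * sQ' α j a with hQ
  have hNB0 : 0 ≤ NB :=
    sum_nonneg (fun a ha => mul_nonneg (hlam a (by have := mem_range.1 ha; omega)) (by unfold sQy; positivity))
  have hQ0 : 0 ≤ Q :=
    sum_nonneg (fun a ha => mul_nonneg (hmu a (by have := mem_range.1 ha; omega)) (by unfold sQ'; positivity))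
  set Mp : ℚ := NB / ((Fintype.card α : ℚ) - j) with hMp_def
  set Mm : ℚ := Q / ((Fintype.card α : ℚ) - j) with hMm_def
  have hMp0 : 0 ≤ Mp := div_nonneg hNB0 hnj.le
  have hMm0 : 0 ≤ Mm := div_nonneg hQ0 hnj.le
  have hMp : ∀ B ∈ D, ∀ x ∉ B, max (errE α j D B x) 0 ≤ Mp := by
    intro B hB x hx
    calc max (errE α j D B x) 0
        ≤ (∑ B' ∈ (D.erase B).filter (fun B' => x ∉ B'), eDef α j (B ∩ B').card) / ((Fintype.card α : ℚ) - j) :=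
          max_errE_le_avoid hD hn2 hjn hB x
      _ ≤ Mp := by
          rw [hMp_def]
          apply div_le_div_of_nonneg_right _ hnj.le
          apply sum_eDef_avoid_le_of_cert_of_no_near (isCode_erase hD B) hj (hD.1 B hB) (notMem_erase B D) hx _
            lam hlam hcert
          intro B' hB'
          have hne : B ≠ B' := (ne_of_mem_erase hB').symm
          have := hD.2 B hB B' (mem_of_mem_erase hB') hne
          omega
  have hMm : ∀ B ∈ D, ∀ x ∉ B, max (- errE α j D B x) 0 ≤ Mm := by
    intro B hB x hx
    calc max (- errE α j D B x) 0
        ≤ (∑ B' ∈ (D.erase B).filter (fun B' => x ∈ B'), gDef α j (B ∩ B').card) / ((Fintype.card α : ℚ) - j) :=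
          max_neg_errE_le hD hn2 hjn hB x
      _ ≤ Mm := by
          rw [hMm_def]
          apply div_le_div_of_nonneg_right _ hnj.le
          exact sum_gDef_through_le_of_cert hD hj hB hx mu hmu hcertm
  set c : ℚ := ((punctured j D).card : ℚ) / (levelAbove α j).card with hc_def
  have hc0 : 0 ≤ c := by positivity
  refine puncturedNMP_of_weights (fun X Y => totalWp α j D X Y / c) ?_ ?_ ?_
  · intro X hX Y hY
    obtain ⟨hXc, hXD⟩ := mem_punctured.1 hX
    rw [sups_eq hXc] at hY
    obtain ⟨y, hy, rfl⟩ := mem_image.1 hY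
    have hyX : y ∉ X := (mem_sdiff.1 hy).2
    rw [totalWp_insert j D X hyX]
    apply div_nonneg _ hc0
    have h1 := superW_ge_avoid hD hn2 hjn X y
    have h2 := sum_reroute_ge2 hD hjn hMp0 hMm0 hMp hMm hXc hyX
    have hN := sum_eDef_avoid_le_of_cert hD hj1 hXc hXD hyX lam hlam hcert
    unfold totalW
    have hkey : 0 ≤ (1 - ∑ B ∈ D.filter (fun B => y ∉ B), eDef α j (X ∩ B).card) / ((Fintype.card α : ℚ) - j) -
        (max Mp Mm + ((j : ℚ) - 1) * Mm) / j := by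
      have hmaxdiv : max Mp Mm = max NB Q / ((Fintype.card α : ℚ) - j) := by
        rw [hMp_def, hMm_def]
        rcases le_total NB Q with h | h
        · rw [max_eq_right h, max_eq_right (div_le_div_of_nonneg_right h hnj.le)]
        · rw [max_eq_left h, max_eq_left (div_le_div_of_nonneg_right h hnj.le)]
      rw [hmaxdiv, hMm_def]
      have e : (max NB Q / ((Fintype.card α : ℚ) - j) + ((j : ℚ) - 1) * (Q / ((Fintype.card α : ℚ) - j))) / j =
          ((max NB Q + ((j : ℚ) - 1) * Q) / j) / ((Fintype.card α : ℚ) - j) := by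
        field_simp
      rw [e, ← sub_div]
      apply div_nonneg _ hnj.le
      linarith
    rw [neg_div] at h2
    linarith
  · intro X hX
    rw [← sum_div, sum_sups_totalWp hD hjn hX, hc_def, one_div_div]
  · intro Y hY
    rw [← sum_div, sum_subsP_totalWp hD hj0 hjn (mem_levelAbove.1 hY), ← hc_def]
    rcases eq_or_ne c 0 with hc | hc
    · rw [hc, div_zero]
      exact zero_le_one
    · rw [div_self hc]

end PercRepro.PuncturedLYM
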